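import Summits.CriticalPhenomena.CardyFormulaZ2.Theorems.CardyBoundaryCoulombGasBoundaryDefectGaussianRStubRealisabilityPart27
import Summits.CriticalPhenomena.CardyFormulaZ2.Theorems.CardyBoundaryCoulombGasBoundaryDefectGaussianRStubRealisabilityPart34

/-!
# Stub `stub_dictionaryPositivity` of line `rainbow-monomials-in-excursion-kernels` — Part 35:
# tracked cuts are strand ends (I): gap-face bookkeeping of exterior darts on a pinch-free `V`
# (crux `BoundaryDefectGaussianR`, stmt-CriticalPhenomena-14132; insertion dictionary D2, layer 3b)

First of four files proving hypothesis (E1) of the rainbow forcing `s14_rainbow_of_valid`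
(Part 18) for the jump collar of an ADMISSIBLE leg insertion with FLAT insertion points on a `V`
with local CHARTS (hypotheses `FLAT`, `CHART` of Part 34): EVERY TRACKED CUT CORNER IS A REGISTERED
STRAND END (`s14_trackedCuts_are_ends`, Part 38). This file is the lattice bookkeeping:

* `tc_noPinch_of_chart` — the local charts exclude diagonal pinches (hypothesis `NoPinch` of
  Part 13 follows from `CHART`);
* gap faces of exterior darts: `tc_gapFace_inj` (on a pinch-free `V` the gap face determines the
  exterior dart), `tc_gapFace_of_dsucc` (the gap face of a `dsucc`-predecessor of `(v, K)` is the
  face before `(v, K)`, i.e. `gapFace (v - dir (K+1), K)`), `tc_exists_pred` (every exterior dart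
  has an exterior `dsucc`-predecessor), `tc_gapFace_mem_bdryFaces`;
* faces and edges at a corner: `tc_exists_dart_of_face` (a face with a corner in `V` and the
  corner `g ∉ V` is the gap face of an exterior dart), `tc_target_mem_faceEdges` (the target edge
  of the corner `(g, k)` is an edge of its face `gapFace (g, k)`), `tc_leftFaces_of_dart` (the two
  side faces of the exterior edge at `v` in direction `K` are the faces after / before the dart
  `(v, K)`), `tc_mem_neighbours`.

Registered one-line form: `s14_trackedCuts_gapFaces`. All [folklore].
-/

namespace Summit.CriticalPhenomena.CardyFormulaZ2.Cruxes.BoundaryDefectGaussianR.RainbowMonomialsInExcursionKernels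

open Literature.Probability.LatticeModels Literature.Probability.LatticeModels.CollarLegModel

/-! ### Local charts exclude diagonal pinches -/

/-- **`CHART` implies `NoPinch`.** If every boundary vertex of `V` carries a half-plane / convex /
reflex lattice chart on the box of radius `3`, no unit square meets `V` in exactly two diagonal
corners. [folklore] -/
theorem tc_noPinch_of_chart {V : Finset (ℤ × ℤ)}
    (hchart : ∀ u ∈ V, ∀ k : Fin 4, u + dir k ∉ V → ∃ (K : Fin 4) (c₁ c₂ : ℤ),
      (∀ v : ℤ × ℤ, |v.1 - u.1| ≤ 3 → |v.2 - u.2| ≤ 3 →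
        (v ∈ V ↔ c₂ ≤ v.1 * (dir (K + 1)).1 + v.2 * (dir (K + 1)).2)) ∨
      (∀ v : ℤ × ℤ, |v.1 - u.1| ≤ 3 → |v.2 - u.2| ≤ 3 →
        (v ∈ V ↔ c₁ ≤ v.1 * (dir K).1 + v.2 * (dir K).2 ∧
          c₂ ≤ v.1 * (dir (K + 1)).1 + v.2 * (dir (K + 1)).2)) ∨
      (∀ v : ℤ × ℤ, |v.1 - u.1| ≤ 3 → |v.2 - u.2| ≤ 3 →
        (v ∈ V ↔ c₂ ≤ v.1 * (dir (K + 1)).1 + v.2 * (dir (K + 1)).2 ∨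
          v.1 * (dir K).1 + v.2 * (dir K).2 ≤ c₁))) :
    ∀ x y : ℤ, ((x, y) ∈ V → (x + 1, y + 1) ∈ V → (x + 1, y) ∈ V ∨ (x, y + 1) ∈ V) ∧
      ((x + 1, y) ∈ V → (x, y + 1) ∈ V → (x, y) ∈ V ∨ (x + 1, y + 1) ∈ V) := by
  intro x y
  constructor
  · intro h00 h11
    by_contra hno
    push Not at hno
    obtain ⟨h10, h01⟩ := hno
    obtain ⟨K, c₁, c₂, hf⟩ := hchart (x, y) h00 0 (by simpa [dir] using h10)
    rcases hf with hf | hf | hf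
    · have a := (hf (x, y) (by simp) (by simp)).1 h00
      have b := (hf (x + 1, y + 1) (by simp) (by simp)).1 h11
      have c := mt (hf (x + 1, y) (by simp) (by simp)).2 h10
      have d := mt (hf (x, y + 1) (by simp) (by simp)).2 h01
      fin_cases K <;> simp [dir] at a b c d <;> omega
    · have a := (hf (x, y) (by simp) (by simp)).1 h00
      have b := (hf (x + 1, y + 1) (by simp) (by simp)).1 h11
      have c := mt (hf (x + 1, y) (by simp) (by simp)).2 h10
      have d := mt (hf (x, y + 1) (by simp) (by simp)).2 h01
      fin_cases K <;> simp [dir] at a b c d <;> omega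
    · have a := (hf (x, y) (by simp) (by simp)).1 h00
      have b := (hf (x + 1, y + 1) (by simp) (by simp)).1 h11
      have c := mt (hf (x + 1, y) (by simp) (by simp)).2 h10
      have d := mt (hf (x, y + 1) (by simp) (by simp)).2 h01
      fin_cases K <;> simp [dir] at a b c d <;> omega
  · intro h10 h01
    by_contra hno
    push Not at hno
    obtain ⟨h00, h11⟩ := hno
    obtain ⟨K, c₁, c₂, hf⟩ := hchart (x + 1, y) h10 2 (by simpa [dir] using h00)
    rcases hf with hf | hf | hf
    · have a := (hf (x + 1, y) (by simp) (by simp)).1 h10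
      have b := (hf (x, y + 1) (by simp) (by simp)).1 h01
      have c := mt (hf (x, y) (by simp) (by simp)).2 h00
      have d := mt (hf (x + 1, y + 1) (by simp) (by simp)).2 h11
      fin_cases K <;> simp [dir] at a b c d <;> omega
    · have a := (hf (x + 1, y) (by simp) (by simp)).1 h10
      have b := (hf (x, y + 1) (by simp) (by simp)).1 h01
      have c := mt (hf (x, y) (by simp) (by simp)).2 h00
      have d := mt (hf (x + 1, y + 1) (by simp) (by simp)).2 h11
      fin_cases K <;> simp [dir] at a b c d <;> omega
    · have a := (hf (x + 1, y) (by simp) (by simp)).1 h10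
      have b := (hf (x, y + 1) (by simp) (by simp)).1 h01
      have c := mt (hf (x, y) (by simp) (by simp)).2 h00
      have d := mt (hf (x + 1, y + 1) (by simp) (by simp)).2 h11
      fin_cases K <;> simp [dir] at a b c d <;> omega

/-! ### Gap faces of exterior darts -/

/-- A dart at the diagonal corner with the same gap face as `(c, K)` points the opposite way. [folklore] -/
theorem tc_gapFace_diag (c : ℤ × ℤ) {K k : Fin 4} (h : gapFace (c + dir K + dir (K + 1), k) = gapFace (c, K)) :
    k = K + 2 := by
  obtain ⟨p, q⟩ := c
  fin_cases K <;> fin_cases k <;> simp [gapFace, tp_dir_val, Prod.ext_iff] at h ⊢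

/-- **On a pinch-free `V` the gap face determines the exterior dart.** [folklore] -/
theorem tc_gapFace_inj {V : Finset (ℤ × ℤ)}
    (hnp : ∀ x y : ℤ, ((x, y) ∈ V → (x + 1, y + 1) ∈ V → (x + 1, y) ∈ V ∨ (x, y + 1) ∈ V) ∧
      ((x + 1, y) ∈ V → (x, y + 1) ∈ V → (x, y) ∈ V ∨ (x + 1, y + 1) ∈ V))
    {d d' : Dart} (hd1 : d.1 ∈ V) (hd2 : d.1 + dir d.2 ∉ V) (hd1' : d'.1 ∈ V) (hd2' : d'.1 + dir d'.2 ∉ V)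
    (h : gapFace d' = gapFace d) : d' = d := by
  obtain ⟨u, j⟩ := d
  obtain ⟨u', j'⟩ := d'
  simp only at hd1 hd2 hd1' hd2'
  have hu' : u' ∈ SixVertex.faceCorners (gapFace (u, j)) := h ▸ se_self_mem_faceCorners_gapFace (u', j')
  rw [mem_faceCorners_gapFace] at hu'
  rcases hu' with rfl | rfl | rfl | rfl
  · rw [se_gapFace_inj_dir u' h]
  · exact absurd hd1' hd2
  · exfalso
    have hk := se_gapFace_next u h
    subst hk
    rw [tp_dir_add_three, ← sub_eq_add_neg, add_sub_cancel_right] at hd2'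
    exact hd2' hd1
  · exfalso
    have hk := tc_gapFace_diag u h
    subst hk
    have e : u + dir j + dir (j + 1) + dir (j + 2) = u + dir (j + 1) := by rw [tp_dir_add_two]; abel
    rw [e] at hd2'
    rcases noPinch_dir hnp hd1 hd1' with h1 | h1
    · exact hd2 h1
    · exact hd2' h1

/-- **The gap face of a predecessor.** If `dsucc V d = (v, K)` then the gap face of `d` is the face
before the dart `(v, K)` at `v`, namely `gapFace (v - dir (K+1), K)` (whatever the turn at `v`).
[folklore] -/
theorem tc_gapFace_of_dsucc {V : Finset (ℤ × ℤ)} {d : Dart} {v : ℤ × ℤ} {K : Fin 4}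
    (h : dsucc V d = (v, K)) : gapFace d = gapFace (v - dir (K + 1), K) := by
  obtain ⟨⟨a, b⟩, j⟩ := d
  obtain ⟨p, q⟩ := v
  unfold dsucc at h
  split_ifs at h with h1 h2 <;> obtain ⟨h', rfl⟩ := Prod.mk.inj h <;> fin_cases j <;>
    simp [gapFace, dir, Prod.ext_iff] at h' ⊢ <;> omega

/-- **Every exterior dart has an exterior `dsucc`-predecessor** (its orbit is a cycle). [folklore] -/
theorem tc_exists_pred (V : Finset (ℤ × ℤ)) {d : Dart} (hd1 : d.1 ∈ V) (hd2 : d.1 + dir d.2 ∉ V) :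
    ∃ d' : Dart, d'.1 ∈ V ∧ d'.1 + dir d'.2 ∉ V ∧ dsucc V d' = d := by
  obtain ⟨hpos, -, hret, -⟩ := s3_period_spec V d hd1 hd2
  refine ⟨(dsucc V)^[period V d - 1] d, ((s3_dsucc_iterate V _).1 d hd1 hd2).1,
    ((s3_dsucc_iterate V _).1 d hd1 hd2).2, ?_⟩
  rw [← Function.iterate_succ_apply' (dsucc V), Nat.succ_eq_add_one, Nat.sub_add_cancel hpos, hret]

/-- The gap face of an exterior dart is a boundary face of `V`. [folklore] -/
theorem tc_gapFace_mem_bdryFaces {V : Finset (ℤ × ℤ)} {d : Dart} (hd1 : d.1 ∈ V) (hd2 : d.1 + dir d.2 ∉ V) :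
    gapFace d ∈ SixVertex.bdryFaces V := by
  rw [SixVertex.bdryFaces, Finset.mem_filter]
  refine ⟨?_, fun hsub => hd2 (hsub ?_)⟩
  · rw [SixVertex.faces, Finset.mem_biUnion]
    exact ⟨d.1, hd1, mem_vertexFaces_of_mem_faceCorners (se_self_mem_faceCorners_gapFace d)⟩
  · obtain ⟨u, k⟩ := d
    exact (mem_faceCorners_gapFace u _ k).2 (Or.inr (Or.inl rfl))

/-! ### Faces and edges at a corner -/

/-- **A face-cell at a point outside `V` is the gap face of an exterior dart.** If `g ∉ V` and the
face `gapFace (g, k)` (the face of the corner `(g, k)`) has a corner in `V`, then it is the gap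
face of an exterior dart (going round the face counter-clockwise there is a step from `V` out of
`V`). [folklore] -/
theorem tc_exists_dart_of_face {V : Finset (ℤ × ℤ)} {g : ℤ × ℤ} (hg : g ∉ V) (k : Fin 4)
    (hu : ∃ u ∈ V, u ∈ SixVertex.faceCorners (gapFace (g, k))) :
    ∃ d : Dart, d.1 ∈ V ∧ d.1 + dir d.2 ∉ V ∧ gapFace d = gapFace (g, k) := by
  have e1 : gapFace (g + dir (k + 1), k + 3) = gapFace (g, k) := by
    obtain ⟨p, q⟩ := g; fin_cases k <;> simp [gapFace, dir] <;> omega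
  have e2 : gapFace (g + dir k + dir (k + 1), k + 2) = gapFace (g, k) := by
    obtain ⟨p, q⟩ := g; fin_cases k <;> simp [gapFace, dir] <;> omega
  have e3 : gapFace (g + dir k, k + 1) = gapFace (g, k) := by
    obtain ⟨p, q⟩ := g; fin_cases k <;> simp [gapFace, dir] <;> omega
  have t1 : g + dir (k + 1) + dir (k + 3) = g := by rw [tp_dir_add_three]; abel
  have t2 : g + dir k + dir (k + 1) + dir (k + 2) = g + dir (k + 1) := by rw [tp_dir_add_two]; abel
  by_cases hC : g + dir (k + 1) ∈ V
  · exact ⟨(g + dir (k + 1), k + 3), hC, by rw [t1]; exact hg, e1⟩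
  by_cases hB : g + dir k + dir (k + 1) ∈ V
  · exact ⟨(g + dir k + dir (k + 1), k + 2), hB, by rw [t2]; exact hC, e2⟩
  by_cases hA : g + dir k ∈ V
  · exact ⟨(g + dir k, k + 1), hA, hB, e3⟩
  exfalso
  obtain ⟨u, huV, hu⟩ := hu
  rw [mem_faceCorners_gapFace] at hu
  rcases hu with rfl | rfl | rfl | rfl
  · exact hg huV
  · exact hA huV
  · exact hC huV
  · exact hB huV

/-- **The target edge of a corner is an edge of its face**: a coded edge with endpoints `g` and
`g + dir (k+1)` is an edge of `gapFace (g, k)`. [folklore] -/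
theorem tc_target_mem_faceEdges (g : ℤ × ℤ) (k : Fin 4) {e : (ℤ × ℤ) × Bool}
    (hend : (e.1 = g ∧ SixVertex.edgeTip e = g + dir (k + 1)) ∨ (e.1 = g + dir (k + 1) ∧ SixVertex.edgeTip e = g)) :
    e ∈ faceEdges (gapFace (g, k)) := by
  obtain ⟨⟨a, b⟩, bb⟩ := e
  obtain ⟨p, q⟩ := g
  fin_cases k <;> cases bb <;>
    simp [SixVertex.edgeTip, faceEdges, gapFace, dir, Prod.ext_iff] at hend ⊢ <;> omega

/-- **The side faces of an exterior edge.** A coded edge with endpoints `v` and `v + dir K` has as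
its two side faces the gap face after the dart `(v, K)` and the face before it,
`gapFace (v - dir (K+1), K)`. [folklore] -/
theorem tc_leftFaces_of_dart (v : ℤ × ℤ) (K : Fin 4) {e : (ℤ × ℤ) × Bool}
    (hend : (e.1 = v ∧ SixVertex.edgeTip e = v + dir K) ∨ (e.1 = v + dir K ∧ SixVertex.edgeTip e = v)) :
    (SixVertex.leftFace e true = gapFace (v, K) ∧ SixVertex.leftFace e false = gapFace (v - dir (K + 1), K)) ∨
      (SixVertex.leftFace e false = gapFace (v, K) ∧ SixVertex.leftFace e true = gapFace (v - dir (K + 1), K)) := by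
  obtain ⟨⟨a, b⟩, bb⟩ := e
  obtain ⟨p, q⟩ := v
  fin_cases K <;> cases bb <;>
    simp [SixVertex.edgeTip, SixVertex.leftFace, gapFace, dir, Prod.ext_iff] at hend ⊢ <;> omega

/-- Lattice neighbours are unit steps. [folklore] -/
theorem tc_mem_neighbours {a g : ℤ × ℤ} (h : g ∈ neighbours a) : ∃ k : Fin 4, g = a + dir k := by
  obtain ⟨p, q⟩ := a
  simp only [neighbours, Finset.mem_insert, Finset.mem_singleton] at h
  rcases h with rfl | rfl | rfl | rfl
  · exact ⟨0, by simp [dir]⟩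
  · exact ⟨1, by simp [dir]⟩
  · exact ⟨2, by simp [dir, sub_eq_add_neg]⟩
  · exact ⟨3, by simp [dir, sub_eq_add_neg]⟩

/-- A corner of a pocket lying outside `V` is a ghost. [folklore] -/
theorem tc_ghost_of_pocketCorner (M : CollarLegModel) {p x : ℤ × ℤ} (hp : p ∈ M.pockets)
    (hx : x ∈ SixVertex.faceCorners p) (hxV : x ∉ M.V) : x ∈ M.ghosts :=
  Finset.mem_sdiff.2 ⟨Finset.mem_union_right _ (Finset.mem_biUnion.2 ⟨p, hp, hx⟩), hxV⟩

/-- The ghost `v + dir K` of an arc vertex `v` (with `v + dir K ∉ V`) is a ghost, and the coded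
edge joining them is a frozen OPEN edge (a spoke). [folklore] -/
theorem tc_spoke_open (M : CollarLegModel) {v : ℤ × ℤ} {K : Fin 4} (hv : v ∈ M.arcVerts)
    (hg : v + dir K ∉ M.V) {e : (ℤ × ℤ) × Bool}
    (hend : (e.1 = v ∧ SixVertex.edgeTip e = v + dir K) ∨ (e.1 = v + dir K ∧ SixVertex.edgeTip e = v)) :
    v + dir K ∈ M.ghosts ∧ e ∈ M.openEdges := by
  have hvV : v ∈ M.V := (Finset.mem_inter.1 hv).2
  have hgh : v + dir K ∈ M.ghosts :=
    Finset.mem_sdiff.2 ⟨Finset.mem_union_left _ (Finset.mem_biUnion.2 ⟨v, hv, se_ghost_mem_neighbours v K⟩), hg⟩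
  refine ⟨hgh, Finset.mem_filter.2 ⟨?_, ?_⟩⟩
  · rw [frozenEdges, Finset.mem_sdiff, SixVertex.mem_edges_iff, E, inducedEdges, Finset.mem_filter]
    rcases hend with ⟨h1, h2⟩ | ⟨h1, h2⟩ <;> rw [h1, h2]
    · exact ⟨Or.inl (Finset.mem_union_left _ hvV), fun hh => hg hh.2.2⟩
    · exact ⟨Or.inr (Finset.mem_union_left _ hvV), fun hh => hg hh.2.1⟩
  · rcases hend with ⟨h1, h2⟩ | ⟨h1, h2⟩ <;> rw [h1, h2]
    · exact Or.inl ⟨hv, hgh⟩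
    · exact Or.inr (Or.inl ⟨hv, hgh⟩)

/-- An edge of a pocket with both endpoints outside `V`, one of them a vertex-cell, is a frozen
OPEN edge. [folklore] -/
theorem tc_pocketEdge_open (M : CollarLegModel) {p : ℤ × ℤ} (hp : p ∈ M.pockets) {e : (ℤ × ℤ) × Bool}
    (he : e ∈ faceEdges p) (h1 : e.1 ∉ M.V) (h2 : SixVertex.edgeTip e ∉ M.V)
    (hcell : e.1 ∈ M.vertexCells ∨ SixVertex.edgeTip e ∈ M.vertexCells) : e ∈ M.openEdges := by
  refine Finset.mem_filter.2 ⟨?_, Or.inr (Or.inr ⟨h1, h2, p, hp, he⟩)⟩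
  rw [frozenEdges, Finset.mem_sdiff, SixVertex.mem_edges_iff, E, inducedEdges, Finset.mem_filter]
  exact ⟨hcell, fun hh => h1 hh.2.1⟩

/-! ### A wider frame chart at an active dart -/

/-- **Flat insertion point ⇒ frame chart, one step wider.** As `se_chart_of_flat` (Part 20), but for
`-3 ≤ s ≤ L + 2` (still inside the Euclidean ball of radius `L + 3` for `|t| ≤ 2`). [folklore] -/
theorem tc_chart_of_flat (V : Finset (ℤ × ℤ)) (x : ℤ × ℤ) (K : Fin 4) (L : ℕ) (hL : 1 ≤ L)
    (hxK : x + dir K ∉ V) {d : ℤ × ℤ} (hd : d = (1, 0) ∨ d = (-1, 0) ∨ d = (0, 1) ∨ d = (0, -1))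
    (hflat : ∀ v : ℤ × ℤ, (v.1 - x.1) ^ 2 + (v.2 - x.2) ^ 2 ≤ ((L : ℤ) + 3) ^ 2 →
      (v ∈ V ↔ 0 ≤ (v.1 - x.1) * d.1 + (v.2 - x.2) * d.2)) :
    ∀ s t : ℤ, -3 ≤ s → s ≤ (L : ℤ) + 2 → -2 ≤ t → t ≤ 2 →
      (x + s • dir (K + 1) + t • dir K ∈ V ↔ t ≤ 0) := by
  have hdK : d = -dir K := flat_dir_eq hd hflat (by omega) hxK
  intro s t hs1 hs2 ht1 ht2
  have hdist : ((x + s • dir (K + 1) + t • dir K).1 - x.1) ^ 2 +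
      ((x + s • dir (K + 1) + t • dir K).2 - x.2) ^ 2 ≤ ((L : ℤ) + 3) ^ 2 := by
    rw [se_frame_normSq]
    have hL' : (1 : ℤ) ≤ L := by exact_mod_cast hL
    by_cases hs3 : s ≤ 3
    · nlinarith
    · nlinarith
  rw [hflat _ hdist, hdK]
  have hc := (tp_coord K x s t).1
  simp only [Prod.fst_neg, Prod.snd_neg, mul_neg, ← neg_add, neg_nonneg]
  rw [hc]

section ActiveRail

variable (ι : LegInsertionData) (V : Finset (ℤ × ℤ)) {d₀ : Dart} (hadm : ι.IsAdmissible V)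
  (h : outDart V ι.sink = some d₀) {st : ℕ → WalkState}
  (hst : ∀ t, st t = List.foldl (fun s d => s.step (ι.startAt V d)) ι.init ((cycle V d₀).take t))

include hadm h hst in
/-- **Active darts are rail darts, with a frame chart of half-width `3`.** If the level changes at
dart `t` (flat insertion points at radius `L + 3`), then `ds[t] = (c, K)` with
`c + s • dir (K+1) + t' • dir K ∈ V ↔ t' ≤ 0` for `-3 ≤ s ≤ 3`, `|t'| ≤ 2` (one rail point more on
each side than `se_active_rail`). [folklore] -/
theorem tc_active_rail3
    (hflat : ∀ x ∈ insert ι.sink ι.source, ∃ d : ℤ × ℤ, (d = (1, 0) ∨ d = (-1, 0) ∨ d = (0, 1) ∨ d = (0, -1)) ∧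
      ∀ v : ℤ × ℤ, (v.1 - x.1) ^ 2 + (v.2 - x.2) ^ 2 ≤ ((ι.sinkLegs : ℤ) + 3) ^ 2 →
        (v ∈ V ↔ 0 ≤ (v.1 - x.1) * d.1 + (v.2 - x.2) * d.2))
    {t : ℕ} (ht : t < (cycle V d₀).length) (hact : (st (t + 1)).level ≠ (st t).level) :
    ∃ (c : ℤ × ℤ) (K : Fin 4),
      (∀ s t : ℤ, -3 ≤ s → s ≤ 3 → -2 ≤ t → t ≤ 2 → (c + s • dir (K + 1) + t • dir K ∈ V ↔ t ≤ 0)) ∧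
      (cycle V d₀)[t] = (c, K) := by
  obtain ⟨s, hst', hts, hne⟩ := se_active_footprint ι V hadm hst ht hact
  obtain ⟨⟨L', σ⟩, hso⟩ := Option.ne_none_iff_exists'.1 hne
  obtain ⟨hx, hout, -, -, -⟩ := se_startAt_some ι V hadm h hso
  obtain ⟨-, hcard, -⟩ := hadm.2.2.2.1 _ hx
  obtain ⟨K, hout', hK, -⟩ := s3_outDart_of_card V _ hcard
  obtain ⟨dv, hd, hfl⟩ := hflat _ hx
  have hch := tc_chart_of_flat V _ K ι.sinkLegs (sinkLegs_pos ι V hadm) hK hd hfl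
  have hds : (cycle V d₀)[s] = (((cycle V d₀)[s]).1, K) := Option.some.inj (hout.symm.trans hout')
  set x := ((cycle V d₀)[s]).1 with hx_def
  have hch' : ∀ s t : ℤ, -3 ≤ s → s ≤ (ι.sinkLegs : ℤ) + 1 → -2 ≤ t → t ≤ 2 →
      (x + s • dir (K + 1) + t • dir K ∈ V ↔ t ≤ 0) :=
    fun s t hs1 hs2 ht1 ht2 => hch s t hs1 (by omega) ht1 ht2
  obtain ⟨hrun, -, -⟩ := se_run ι V hadm h hch' (by omega) hds
  have hL := sinkLegs_pos ι V hadm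
  set j := t - s with hj_def
  have htj : t = s + j := by omega
  refine ⟨x + (j : ℤ) • dir (K + 1), K, fun s' t' hs1 hs2 ht1 ht2 => ?_, ?_⟩
  · have e : x + (j : ℤ) • dir (K + 1) + s' • dir (K + 1) + t' • dir K =
        x + ((j : ℤ) + s') • dir (K + 1) + t' • dir K := by module
    rw [e]
    exact hch _ _ (by omega) (by omega) ht1 ht2
  · have := hrun j (by omega) (by omega)
    simp only [← htj] at this
    exact this

end ActiveRail

/-! ### Registered one-line form -/

/-- **Sub-goal `s14_trackedCuts_gapFaces`** (registered on stmt-CriticalPhenomena-14132): gap-face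
bookkeeping of exterior darts — on a PINCH-FREE `V` the gap face determines the exterior dart, the
gap face of a `dsucc`-predecessor of `(v, K)` is the face `gapFace (v - dir (K+1), K)` before it,
every exterior dart has an exterior predecessor, and a face with a corner in `V` at a point
`g ∉ V` is the gap face of an exterior dart. [folklore] -/
theorem s14_trackedCuts_gapFaces : ∀ (V : Finset (ℤ × ℤ)), ((∀ x y : ℤ, ((x, y) ∈ V → (x + 1, y + 1) ∈ V → (x + 1, y) ∈ V ∨ (x, y + 1) ∈ V) ∧ ((x + 1, y) ∈ V → (x, y + 1) ∈ V → (x, y) ∈ V ∨ (x + 1, y + 1) ∈ V)) → ∀ d d' : Literature.Probability.LatticeModels.CollarLegModel.Dart, d.1 ∈ V → d.1 + Literature.Probability.LatticeModels.CollarLegModel.dir d.2 ∉ V → d'.1 ∈ V → d'.1 + Literature.Probability.LatticeModels.CollarLegModel.dir d'.2 ∉ V → Literature.Probability.LatticeModels.CollarLegModel.gapFace d' = Literature.Probability.LatticeModels.CollarLegModel.gapFace d → d' = d) ∧ (∀ (d : Literature.Probability.LatticeModels.CollarLegModel.Dart) (v : ℤ × ℤ) (K : Fin 4), Literature.Probability.LatticeModels.CollarLegModel.dsucc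 V d = (v, K) → Literature.Probability.LatticeModels.CollarLegModel.gapFace d = Literature.Probability.LatticeModels.CollarLegModel.gapFace (v - Literature.Probability.LatticeModels.CollarLegModel.dir (K + 1), K)) ∧ (∀ d : Literature.Probability.LatticeModels.CollarLegModel.Dart, d.1 ∈ V → d.1 + Literature.Probability.LatticeModels.CollarLegModel.dir d.2 ∉ V → ∃ d' : Literature.Probability.LatticeModels.CollarLegModel.Dart, d'.1 ∈ V ∧ d'.1 + Literature.Probability.LatticeModels.CollarLegModel.dir d'.2 ∉ V ∧ Literature.Probability.LatticeModels.CollarLegModel.dsucc V d' = d) ∧ (∀ (g : ℤ × ℤ) (k : Fin 4), g ∉ V → (∃ u ∈ V, u ∈ Literature.Probability.LatticeModels.SixVertex.faceCorners (Literature.Probability.LatticeModels.CollarLegModel.gapFace (g, k))) → ∃ d : Literature.Probability.LatticeModels.CollarLegModel.Dart, d.1 ∈ V ∧ d.1 + Literature.Probability.LatticeModels.CollarLegModel.dir d.2 ∉ V ∧ Literature.Probability.LatticeModels.CollarLegModel.gapFace d = Literature.Probability.LatticeModels.CollarLegModel.gapFace (g, k)) :=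
  fun V => ⟨fun hnp _ _ hd1 hd2 hd1' hd2' h => tc_gapFace_inj hnp hd1 hd2 hd1' hd2' h,
    fun _ _ _ h => tc_gapFace_of_dsucc h, fun _ hd1 hd2 => tc_exists_pred V hd1 hd2,
    fun _ k hg hu => tc_exists_dart_of_face hg k hu⟩

end Summit.CriticalPhenomena.CardyFormulaZ2.Cruxes.BoundaryDefectGaussianR.RainbowMonomialsInExcursionKernels
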